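import Mathlib.Algebra.Group.Subgroup.Pointwise
import Literature.AnabelianGeometry.AbsoluteAnabelian.CuspidalizationFactsModel
import HarnessLib

/-!
# [AbsCusp] Def. 1.5 (i) "`Σ`-separated" (REAL, group-theoretic) and Prop. 2.2 (ii)

S. Mochizuki, *Absolute anabelian cuspidalizations of proper hyperbolic curves*, J. Math. Kyoto
Univ. 47 (2007) (held copy `paper:doi-10-1215-kjm-1250281022`; locators = its pages).
Cell abc-iut, layer L4, block W2-B12 = plan/L4/LC1-CHAIN.md §2 M3 (completion): the hypothesis
"`X`, `Y` are `Σ`-separated" of [AbsCusp] Thm. 2.1 (i) — cited by [AbsTopIII] Cor. 1.10 (iii)(f)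
p. 43 — was left as a bare `Prop` parameter `IsSeparated` in `AbsCusp.Thm_2_1_i_model`
(`CuspidalizationFactsModel.lean`, p406112).  This file

* types Def. 1.5 (i) p. 31 as a REAL predicate `AbsCusp.IsSeparated D` on a profinite group `Π`
  together with the family `D` of decomposition groups of the closed points of the
  compactification (`X^{cl+}`, §0 p. 5): "If, for every finite étale covering `X' → X` of `X`
  arising from an open subgroup `Π_{X'} ⊆ Π_X`, it holds that the map from `(X')^{cl+}` to
  conjugacy classes of closed subgroups of `Π_{X'}` given by assigning to a closed point its
  associated decomposition group is injective, then we shall say that `X` is `Σ`-separated."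
  GROUP-THEORETIC READING (standard Galois theory of the covering `X_H → X`, `H = Π_{X'}`): the
  closed points of `X̄_H` over the closed point `x` of `X̄` with decomposition group `D_x` are
  indexed by the double cosets `H \ Π_X / D_x`, the point `H g D_x` having decomposition group
  `H ∩ g D_x g⁻¹` in `Π_{X_H} = H` (well defined up to `H`-conjugacy: `coveringDecomp_sameFibre`);
  so Def. 1.5 (i) says: for every open `H`, `(x, H g D_x) ↦ [H ∩ g D_x g⁻¹]_{H-conj}` is
  injective (`IsSeparated`).  `Σ` is whatever the given `Π` is the pro-`Σ` group of; for
  abc-iut-L4-t1's `CurveModel` (`Π_U` = the full arithmetic fundamental group) this is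
  `Σ = 𝔓𝔯𝔦𝔪𝔢𝔰`.
* its form on a curve of a `CurveModel`: `AbsCusp.decompPlus M U` = the decomposition groups of
  `U^{cl+}` = closed points of `U` (`M.decomp`) ⊔ cusps (`(M.cusps U).Dcusp`), and
  `AbsCusp.IsSeparatedCurve M U`.
* [AbsCusp] Prop. 2.2 (ii) p. 39 as a NAMED FACT relative to `M` (`Prop_2_2_ii_model`): "Suppose
  that `Σ = 𝔓𝔯𝔦𝔪𝔢𝔰`. Then … (ii) The map `x ↦ D_x` from `X^{cl}` to conjugacy classes of closed
  subgroups of `Π_X` is injective, i.e., `X` is `𝔓𝔯𝔦𝔪𝔢𝔰`-separated." — for `X` a PROPER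
  hyperbolic CURVE over a field which is "finite or nonarchimedean local" (§1 p. 6); `CurveModel`
  has characteristic-zero base fields only, so the typed case is the MLF one (`IsMLF`).
* the instantiation `Thm_2_1_i_model_sep` of the `IsSeparated` parameter of
  `AbsCusp.Thm_2_1_i_model` by the real predicate, and the PROVED composition
  `thm_2_1_i_of_prop_2_2_ii`: under `Prop_2_2_ii_model M`, the separatedness hypotheses of
  Thm. 2.1 (i) hold for proper curves over MLFs — i.e. the [AbsTopIII] Cor. 1.10 (iii)(f)
  citation "[Mzk19], Theorem 2.1, (i)" now composes BY NAME over `M`.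

Sanity (kernel): `IsSeparated.eq_of_conj` (level `H = Π`: distinct points have non-conjugate
decomposition groups — the clause `CuspidalData.eq_of_conj` t1 requires of cusps) and
`coveringDecomp_sameFibre` (the fibre bookkeeping is well defined).  HONEST FRAMING: refereed
results typed statements-first (D-0014); typed ≠ discharged; nothing here bears on the disputed
[IUTchIII] Cor. 3.12 beyond being upstream vocabulary; no model is asserted to exist.
-/

noncomputable section

open scoped Classical Pointwise

namespace Literature.AnabelianGeometry.AbsoluteAnabelian

namespace AbsCusp

open AbsTopIII

universe u

variable {E : FundamentalExtension.{u}}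

/-! ### Def. 1.5 (i): the group-theoretic predicate -/

/-- For an open subgroup `H ⊆ Π_X` (the covering `X_H → X`) and the decomposition group `D ⊆ Π_X`
of a closed point `x` of `X̄`, the decomposition group IN `Π_{X_H} = H` of the closed point of
`X̄_H` over `x` indexed by the double coset `H g D`: `H ∩ g D g⁻¹`.
[cite: MochizukiAbsCusp2007, Def 1.5 (i) p.31] -/
def coveringDecomp (H D : Subgroup E.arith) (g : E.arith) : Subgroup E.arith :=
  H ⊓ MulAut.conj g • D

/-- `g`, `g'` index the SAME closed point of `X̄_H` over `x`: the double cosets `H g D_x`,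
`H g' D_x` coincide. [cite: MochizukiAbsCusp2007, Def 1.5 (i) p.31] -/
def SameFibrePoint (H D : Subgroup E.arith) (g g' : E.arith) : Prop :=
  ∃ h ∈ H, ∃ d ∈ D, g' = h * g * d

/-- **Def. 1.5 (i) (`Σ`-separated)**, for a profinite group `Π = E.arith` and the family
`D : ι → Subgroup Π` of decomposition groups of the closed points of the compactification
(`X^{cl+}`): for every open subgroup `H ⊆ Π` [every finite étale covering `X_H → X` arising from
an open subgroup], the map from the closed points of `X̄_H` [pairs `(x, H g D_x)`] to `H`-conjugacy
classes of closed subgroups of `Π_{X_H} = H` [`H ∩ g D_x g⁻¹`] is injective.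
[cite: MochizukiAbsCusp2007, Def 1.5 (i) p.31] -/
def IsSeparated {ι : Type*} (D : ι → Subgroup E.arith) : Prop :=
  ∀ H : Subgroup E.arith, IsOpen (H : Set E.arith) →
    ∀ (i j : ι) (g g' : E.arith),
      (∃ h ∈ H, MulAut.conj h • coveringDecomp H (D i) g = coveringDecomp H (D j) g') →
        i = j ∧ SameFibrePoint H (D i) g g'

/-- WELL-DEFINEDNESS of the fibre bookkeeping: if `g' = h g d` with `h ∈ H`, `d ∈ D`, then
`H ∩ g' D g'⁻¹ = h (H ∩ g D g⁻¹) h⁻¹` — the same closed point of `X̄_H` gives `H`-conjugate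
decomposition groups (the converse of the injectivity in Def. 1.5 (i) is automatic).
[cite: MochizukiAbsCusp2007, Def 1.5 (i) p.31] -/
theorem coveringDecomp_sameFibre {H D : Subgroup E.arith} {g g' : E.arith}
    (hgg' : SameFibrePoint H D g g') :
    ∃ h ∈ H, MulAut.conj h • coveringDecomp H D g = coveringDecomp H D g' := by
  obtain ⟨h, hh, d, hd, rfl⟩ := hgg'
  refine ⟨h, hh, ?_⟩
  rw [coveringDecomp, coveringDecomp, Subgroup.smul_inf, Subgroup.conj_smul_eq_self_of_mem hh,
    map_mul, map_mul, mul_smul, mul_smul, Subgroup.conj_smul_eq_self_of_mem hd]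

/-- At level `H = Π` and `g = 1` the fibre decomposition group is `D` itself.
[cite: MochizukiAbsCusp2007, Def 1.5 (i) p.31] -/
theorem coveringDecomp_top_one (D : Subgroup E.arith) : coveringDecomp ⊤ D 1 = D := by
  simp [coveringDecomp]

/-- Level `H = Π`: a separated family has pairwise NON-CONJUGATE members ("the map `x ↦ D_x` … to
conjugacy classes of closed subgroups of `Π_X` is injective", Prop. 2.2 (ii) p. 39; for cusps this
is the clause `CuspidalData.eq_of_conj`). [cite: MochizukiAbsCusp2007, Def 1.5 (i) p.31] -/
theorem IsSeparated.eq_of_conj {ι : Type*} {D : ι → Subgroup E.arith} (hD : IsSeparated D)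
    {i j : ι} {g : E.arith} (h : MulAut.conj g • D i = D j) : i = j :=
  (hD ⊤ isOpen_univ i j 1 1
    ⟨g, Subgroup.mem_top g, by rw [coveringDecomp_top_one, coveringDecomp_top_one, h]⟩).1

/-! ### The predicate on a curve of a `CurveModel` -/

/-- The decomposition groups of `U^{cl+}` = the closed points of the compactification of `U`
(§0 p. 5): the closed points of `U` (`M.decomp`) and the cusps (`(M.cusps U).Dcusp`).
[cite: MochizukiAbsCusp2007, Def 1.5 (i) p.31] -/
def decompPlus (M : CurveModel.{u}) (U : M.Curve) :
    M.Point U ⊕ (M.cusps U).Cusp → Subgroup (M.ext U).arith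
  | .inl x => M.decomp U x
  | .inr c => (M.cusps U).Dcusp c

/-- "`U` is `Σ`-separated" (Def. 1.5 (i)) for a curve of the model `M` (`Σ = 𝔓𝔯𝔦𝔪𝔢𝔰`: `M.ext U`
is the full arithmetic fundamental group). [cite: MochizukiAbsCusp2007, Def 1.5 (i) p.31] -/
def IsSeparatedCurve (M : CurveModel.{u}) (U : M.Curve) : Prop :=
  IsSeparated (decompPlus M U)

/-- On a separated curve distinct closed points of `U` have non-conjugate decomposition groups.
[cite: MochizukiAbsCusp2007, Prop 2.2 (ii) p.39] -/
theorem IsSeparatedCurve.point_eq_of_conj {M : CurveModel.{u}} {U : M.Curve}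
    (hU : IsSeparatedCurve M U) {x y : M.Point U} {g : (M.ext U).arith}
    (h : MulAut.conj g • M.decomp U x = M.decomp U y) : x = y :=
  Sum.inl_injective (IsSeparated.eq_of_conj hU (i := .inl x) (j := .inl y) h)

/-- On a separated curve no decomposition group of a closed point of `U` is conjugate to a cuspidal
decomposition group. [cite: MochizukiAbsCusp2007, Prop 2.2 (ii) p.39] -/
theorem IsSeparatedCurve.decomp_ne_conj_Dcusp {M : CurveModel.{u}} {U : M.Curve}
    (hU : IsSeparatedCurve M U) (x : M.Point U) (c : (M.cusps U).Cusp) (g : (M.ext U).arith) :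
    MulAut.conj g • M.decomp U x ≠ (M.cusps U).Dcusp c := fun h =>
  Sum.inl_ne_inr (IsSeparated.eq_of_conj hU (i := .inl x) (j := .inr c) h)

/-! ### Prop. 2.2 (ii), p. 39 (named fact, relative to `M`) -/

/-- **[AbsCusp] Prop. 2.2 (ii)** p. 39 relative to `M`: "Suppose that `Σ = 𝔓𝔯𝔦𝔪𝔢𝔰`. Then …
(ii) The map `x ↦ D_x` from `X^{cl}` to conjugacy classes of closed subgroups of `Π_X` is
injective, i.e., `X` is `𝔓𝔯𝔦𝔪𝔢𝔰`-separated." — for every PROPER hyperbolic CURVE `X` of the model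
over a nonarchimedean local field (§1 p. 6 "`X` a proper hyperbolic curve over a field `k` which is
either finite or nonarchimedean local"; only the latter = `IsMLF` occurs in the characteristic-zero
`CurveModel`).  NAMED FACT relative to `M` (printed proof: Kummer theory of the Jacobian,
Prop. 2.2 (i), and [Tama] Cor. 2.10). [cite: MochizukiAbsCusp2007, Prop 2.2 (ii) p.39] -/
def Prop_2_2_ii_model (M : CurveModel.{u}) : Prop :=
  ∀ X : M.Curve, M.IsProper X → M.IsScheme X → IsMLF (M.base X) → IsSeparatedCurve M X

/-! ### Thm. 2.1 (i) with the real separatedness predicate -/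

/-- [AbsCusp] Thm. 2.1 (i) p. 42 relative to `M` (`AbsCusp.Thm_2_1_i_model`, p406112) with its
`Σ`-separatedness parameter INSTANTIATED by Def. 1.5 (i) (`IsSeparatedCurve M`).
[cite: MochizukiAbsCusp2007, Thm 2.1 (i) p.42] -/
abbrev Thm_2_1_i_model_sep (M : CurveModel.{u})
    (hclosed : ∀ (U : M.Curve) (x : M.Point U), IsClosed (M.decomp U x : Set (M.ext U).arith)) :
    Prop :=
  Thm_2_1_i_model M (IsSeparatedCurve M) hclosed

/-- COMPOSITION BY NAME ([AbsTopIII] Cor. 1.10 (iii)(f) p. 43 cites "[Mzk19], Theorem 2.1, (i)"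
for proper curves over MLFs): granted Prop. 2.2 (ii) and Thm. 2.1 (i) relative to `M`, the
conclusion of Thm. 2.1 (i) holds for PROPER hyperbolic CURVES `X`, `Y` over MLFs WITHOUT a
separatedness hypothesis. [cite: MochizukiAbsCusp2007, Thm 2.1 (i) p.42] -/
theorem thm_2_1_i_of_prop_2_2_ii (M : CurveModel.{u})
    {hclosed : ∀ (U : M.Curve) (x : M.Point U), IsClosed (M.decomp U x : Set (M.ext U).arith)}
    (h22 : Prop_2_2_ii_model M) (h21 : Thm_2_1_i_model_sep M hclosed)
    {US X VT Y : M.Curve} (hX : M.IsCofiniteOpen US X) (hY : M.IsCofiniteOpen VT Y)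
    (hsX : Function.Surjective (M.res hX).arith) (hsY : Function.Surjective (M.res hY).arith)
    (hpX : M.IsProper X) (hpY : M.IsProper Y) (hsXs : M.IsScheme X) (hsYs : M.IsScheme Y)
    (hkX : IsMLF (M.base X)) (hkY : IsMLF (M.base Y))
    (α : (M.ext X).arith ≃ₜ* (M.ext Y).arith)
    (hpt : (fun D : Subgroup (M.ext X).arith => D.map α.toMonoidHom) ''
        (GalSect.pointDataOf M X (hclosed X)).decompositionGroups =
      (GalSect.pointDataOf M Y (hclosed Y)).decompositionGroups)
    (hST : ∀ c : (M.cusps US).Cusp, ∃ (d : (M.cusps VT).Cusp) (g : (M.ext Y).arith),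
        (((M.cusps US).Dcusp c).map (M.res hX).arith.toMonoidHom).map α.toMonoidHom =
          MulAut.conj g • ((M.cusps VT).Dcusp d).map (M.res hY).arith.toMonoidHom)
    (hTS : ∀ d : (M.cusps VT).Cusp, ∃ (c : (M.cusps US).Cusp) (g : (M.ext Y).arith),
        (((M.cusps US).Dcusp c).map (M.res hX).arith.toMonoidHom).map α.toMonoidHom =
          MulAut.conj g • ((M.cusps VT).Dcusp d).map (M.res hY).arith.toMonoidHom) :
    Thm_2_1_i (cuspidalizationDataOf M hX hsX) (cuspidalizationDataOf M hY hsY) α :=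
  h21 US X VT Y hX hY hsX hsY hpX hpY hkX hkY (h22 X hpX hsXs hkX) (h22 Y hpY hsYs hkY) α hpt
    hST hTS

end AbsCusp

end Literature.AnabelianGeometry.AbsoluteAnabelian
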